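import Mathlib
import HarnessLib

/-!
# Ring 2 transport — a maximal étale subalgebra of `End_Z(V)` (linear algebra for node 44, converse half; part 2 of 3)

research route conditional on HC_CM; not a corollary; Q11.4-sentence-2 already refuted in dim ≥ 3.

Cell `pub-hodge-ring2`, seat `transport`, gen 51; helper file (pure algebra, no Hodge theory, no open hypothesis).
`Commutant.exists_subalgebra_comm_reduced_finrank_eq`: for a commutative reduced finite-dimensional `F`-algebra `Z`
acting on a finite-dimensional `F`-space `V` (compatibly with `F`), there is an `F`-subalgebra `B ⊆ End_F V` of
`Z`-linear maps which is commutative, reduced, and of dimension `dim_F V` — the sentence "the commutant of `G`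
therefore contains étale commutative algebras of rank `dim H₁(A, ℚ)` over `ℚ`" in Deligne's proof of LNM 900 I
Prop. 5.1. Proof: `Z` is Artinian reduced hence semisimple, `V = ⊕ᵢ Nᵢ` with simple `Nᵢ`
(`IsSemisimpleModule.exists_sSupIndep_sSup_simples_eq_top`), `B` = the image of `(s → Z) → End_F V`,
`z ↦ (zᵢ on Nᵢ)ᵢ`; `dim B = dim V` because `z ↦ Σ zᵢ wᵢ` (`wᵢ ∈ Nᵢ` non-zero) is onto `V` with the same kernel.
Used by `Ring2TransportCMTypeOfCommutativeMumfordTate` (part 3).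
References: Deligne, LNM 900 (1982) I §5, proof of Prop. 5.1.
-/

set_option linter.dupNamespace false

noncomputable section

namespace Summit.HodgeConjecture.HodgeConjecture.Ring2Transport

namespace Commutant

/-! ## §4 Over a commutative reduced algebra `Z` acting on `V`: a commutative reduced subalgebra of
`End_Z(V)` of dimension `dim V` -/

section Etale

variable {F : Type*} [Field F] {Z : Type*} [CommRing Z] [Algebra F Z] [IsReduced Z] [Module.Finite F Z]
  {V : Type*} [AddCommGroup V] [Module F V] [FiniteDimensional F V] [Module Z V] [IsScalarTower F Z V]

/-- **A maximal étale subalgebra of `End_Z(V)`** (the linear algebra of Deligne LNM 900 I §5, proof of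
Prop. 5.1, direction `⇒`: "the commutant of `G` therefore contains étale commutative algebras of rank
`dim H₁(A, ℚ)` over `ℚ`"). For a commutative reduced finite-dimensional `F`-algebra `Z` acting on a
finite-dimensional `V`, there is an `F`-subalgebra `B ⊆ End_F V` of `Z`-linear maps which is commutative and
reduced with `dim_F B = dim_F V`: `Z` is semisimple, `V = ⊕ᵢ Nᵢ` with `Nᵢ` simple `Z`-modules, and `B` = the
maps acting on each `Nᵢ` through `Z` (`≅ ∏ᵢ Z/𝔪ᵢ`, `dim = Σ dim Nᵢ`).
[cite: Deligne1982HodgeCycles, I §5 Prop. 5.1 (proof)] -/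
theorem exists_subalgebra_comm_reduced_finrank_eq :
    ∃ B : Subalgebra F (Module.End F V),
      (∀ x ∈ B, ∀ (c : Z) (v : V), x (c • v) = c • x v) ∧
      (∀ x ∈ B, ∀ y ∈ B, x * y = y * x) ∧ IsReduced B ∧
      Module.finrank F B = Module.finrank F V := by
  classical
  haveI : IsArtinianRing Z := IsArtinianRing.of_finite F Z
  haveI : IsSemisimpleRing Z := IsArtinianRing.isSemisimpleRing_of_isReduced Z
  haveI : IsNoetherian F V := IsNoetherian.iff_fg.2 inferInstance
  haveI : IsNoetherian Z V := isNoetherian_of_tower F (inferInstance : IsNoetherian F V)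
  obtain ⟨s, hind, hsup, hsimple⟩ := IsSemisimpleModule.exists_sSupIndep_sSup_simples_eq_top Z V
  -- the decomposition, indexed by `s`
  let N : s → Submodule Z V := fun W => (W : Submodule Z V)
  have hind' : iSupIndep N := (sSupIndep_iff s).1 hind
  have hsup' : iSup N = ⊤ := by rw [← hsup, sSup_eq_iSup']
  have hint : DirectSum.IsInternal N :=
    DirectSum.isInternal_submodule_of_iSupIndep_of_iSup_eq_top hind' hsup'
  haveI hNs : ∀ i : s, IsSimpleModule Z (N i) := fun i => hsimple i.1 i.2
  have hNbot : ∀ i : s, N i ≠ ⊥ := fun i =>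
    (Submodule.nontrivial_iff_ne_bot).1 (IsSimpleModule.nontrivial Z (N i))
  -- finitely many summands
  have hfin : (Set.univ : Set s).Finite :=
    (WellFoundedGT.finite_ne_bot_of_iSupIndep hind').subset fun i _ => hNbot i
  haveI : Finite s := Set.finite_univ_iff.1 hfin
  letI : Fintype s := Fintype.ofFinite s
  -- every vector is a sum of vectors of the `Nᵢ`
  have hgen : ∀ (p : V → Prop), (∀ i, ∀ w ∈ N i, p w) → p 0 → (∀ u v, p u → p v → p (u + v)) →
      ∀ v, p v := by
    intro p hN h0 hadd v
    have hv : v ∈ iSup N := by rw [hsup']; exact Submodule.mem_top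
    exact Submodule.iSup_induction N (motive := p) hv hN h0 hadd
  -- `V ≅ ⨁ᵢ Nᵢ` and the endomorphism acting by `zᵢ` on `Nᵢ`
  let e : (DirectSum s fun i => ↥(N i)) ≃ₗ[Z] V := LinearEquiv.ofBijective (DirectSum.coeLinearMap N) hint
  let D : (s → Z) → ((DirectSum s fun i => ↥(N i)) →ₗ[Z] V) := fun z =>
    DirectSum.toModule Z s V fun i => (N i).subtype ∘ₗ (z i • LinearMap.id)
  let T : (s → Z) → Module.End F V := fun z => ((D z) ∘ₗ e.symm.toLinearMap).restrictScalars F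
  have hTZ : ∀ (z : s → Z) (c : Z) (v : V), T z (c • v) = c • T z v := fun z c v =>
    ((D z) ∘ₗ e.symm.toLinearMap).map_smul c v
  have hT : ∀ (z : s → Z) (i : s) (w : V) (hw : w ∈ N i), T z w = z i • w := by
    intro z i w hw
    have he : e.symm w = DirectSum.lof Z s (fun i => N i) i ⟨w, hw⟩ := by
      rw [LinearEquiv.symm_apply_eq]
      change w = DirectSum.coeLinearMap N (DirectSum.lof Z s (fun i => ↥(N i)) i ⟨w, hw⟩)
      rw [DirectSum.lof_eq_of, DirectSum.coeLinearMap_of]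
    change D z (e.symm w) = z i • w
    rw [he, DirectSum.toModule_lof]
    rfl
  -- `T` is an `F`-algebra homomorphism `(s → Z) → End_F V`
  have hText : ∀ z z' : s → Z, (∀ (i : s), ∀ w ∈ N i, T z w = T z' w) → T z = T z' := by
    intro z z' h
    apply LinearMap.ext
    exact hgen _ h (by rw [map_zero, map_zero]) (fun u v hu hv => by rw [map_add, map_add, hu, hv])
  have hT1 : T 1 = 1 := by
    apply LinearMap.ext
    refine hgen _ (fun i w hw => ?_) (by rw [map_zero, map_zero])
      (fun u v hu hv => by rw [map_add, map_add, hu, hv])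
    rw [hT 1 i w hw, Pi.one_apply, one_smul, Module.End.one_apply]
  have hTmul : ∀ z z' : s → Z, T (z * z') = T z * T z' := by
    intro z z'
    apply LinearMap.ext
    refine hgen _ (fun i w hw => ?_) (by rw [map_zero, map_zero])
      (fun u v hu hv => by rw [map_add, map_add, hu, hv])
    rw [Module.End.mul_apply, hT z' i w hw, hT z i _ ((N i).smul_mem _ hw), hT _ i w hw, Pi.mul_apply,
      mul_smul]
  have hTadd : ∀ z z' : s → Z, T (z + z') = T z + T z' := by
    intro z z'
    apply LinearMap.ext
    refine hgen _ (fun i w hw => ?_) (by rw [map_zero, map_zero])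
      (fun u v hu hv => by rw [map_add, map_add, hu, hv])
    rw [LinearMap.add_apply, hT z i w hw, hT z' i w hw, hT _ i w hw, Pi.add_apply, add_smul]
  have hTsmul : ∀ (c : F) (z : s → Z), T (c • z) = c • T z := by
    intro c z
    apply LinearMap.ext
    refine hgen _ (fun i w hw => ?_) (by rw [map_zero, map_zero])
      (fun u v hu hv => by rw [map_add, map_add, hu, hv])
    rw [LinearMap.smul_apply, hT z i w hw, hT _ i w hw, Pi.smul_apply, smul_assoc]
  let Tlin : (s → Z) →ₗ[F] Module.End F V :=
    { toFun := T, map_add' := hTadd, map_smul' := hTsmul }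
  let Talg : (s → Z) →ₐ[F] Module.End F V := AlgHom.ofLinearMap Tlin hT1 hTmul
  have hTalg : ∀ z, Talg z = T z := fun z => rfl
  -- `zᵢ` acts on the simple `Nᵢ` by zero or injectively
  have hdich : ∀ (c : Z) (i : s), (∀ w ∈ N i, c • w = 0) ∨ (∀ w ∈ N i, c • w = 0 → w = 0) := by
    intro c i
    rcases LinearMap.bijective_or_eq_zero (c • (LinearMap.id : N i →ₗ[Z] N i)) with hbij | h0
    · refine Or.inr fun w hw h => ?_
      have h3 : (c • (LinearMap.id : N i →ₗ[Z] N i)) ⟨w, hw⟩ = (c • (LinearMap.id : N i →ₗ[Z] N i)) 0 := by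
        apply Subtype.ext
        rw [map_zero, LinearMap.smul_apply, LinearMap.id_apply, Submodule.coe_smul, ZeroMemClass.coe_zero]
        exact h
      exact congrArg Subtype.val (hbij.1 h3)
    · refine Or.inl fun w hw => ?_
      have h3 := LinearMap.congr_fun h0 ⟨w, hw⟩
      rw [LinearMap.smul_apply, LinearMap.id_apply, LinearMap.zero_apply] at h3
      simpa only [Submodule.coe_smul, ZeroMemClass.coe_zero] using congrArg Subtype.val h3
  -- nonzero vectors `wᵢ ∈ Nᵢ`; each generates `Nᵢ`
  have hw : ∀ i : s, ∃ w ∈ N i, w ≠ 0 := fun i => (Submodule.ne_bot_iff (N i)).1 (hNbot i)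
  choose w hwN hw0 using hw
  have hcyc : ∀ (i : s), ∀ u ∈ N i, ∃ c : Z, c • w i = u := by
    intro i u hu
    have hwi0 : (⟨w i, hwN i⟩ : N i) ≠ 0 := fun h => hw0 i (congrArg Subtype.val h)
    have hmem : (⟨u, hu⟩ : N i) ∈ Submodule.span Z {(⟨w i, hwN i⟩ : N i)} := by
      rw [IsSimpleModule.span_singleton_eq_top Z hwi0]; exact Submodule.mem_top
    obtain ⟨c, hc⟩ := Submodule.mem_span_singleton.1 hmem
    exact ⟨c, congrArg Subtype.val hc⟩
  -- if `zᵢ wᵢ = 0` for all `i` then `T z = 0`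
  have hTzero : ∀ z : s → Z, (∀ i, z i • w i = 0) → T z = 0 := by
    intro z hz
    have h : ∀ (i : s), ∀ u ∈ N i, T z u = T 0 u := by
      intro i u hu
      obtain ⟨c, rfl⟩ := hcyc i u hu
      rw [hT z i _ hu, hT 0 i _ hu, Pi.zero_apply, zero_smul, smul_comm, hz i, smul_zero]
    rw [hText z 0 h]
    exact (AlgHom.ofLinearMap Tlin hT1 hTmul).map_zero
  refine ⟨Talg.range, ?_, ?_, ?_, ?_⟩
  · rintro _ ⟨z, rfl⟩ c v
    exact hTZ z c v
  · rintro _ ⟨z, rfl⟩ _ ⟨z', rfl⟩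
    rw [← map_mul, ← map_mul, mul_comm]
  · constructor
    rintro ⟨_, z, rfl⟩ ⟨n, hn⟩
    have hzn : T (z ^ n) = 0 := by
      have := congrArg Subtype.val hn
      rw [SubmonoidClass.coe_pow, ZeroMemClass.coe_zero] at this
      rw [← hTalg, map_pow]
      exact this
    apply Subtype.ext
    show T z = 0
    refine hTzero z fun i => ?_
    rcases hdich (z i) i with h0 | hinj
    · exact h0 (w i) (hwN i)
    · exfalso
      apply hw0 i
      -- `(z i)^k` kills `Nᵢ`, hence `Nᵢ = 0` by injectivity
      have hkill : ∀ (k : ℕ) (u : V), u ∈ N i → (z i) ^ k • u = 0 → u = 0 := by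
        intro k
        induction k with
        | zero => intro u _ h; rwa [pow_zero, one_smul] at h
        | succ k ih =>
          intro u hu h
          rw [pow_succ, mul_smul] at h
          exact hinj u hu (ih (z i • u) ((N i).smul_mem _ hu) h)
      refine hkill n (w i) (hwN i) ?_
      have := LinearMap.congr_fun hzn (w i)
      rwa [hT _ i (w i) (hwN i), Pi.pow_apply, LinearMap.zero_apply] at this
  · -- dimension: `z ↦ T z v₀`, `v₀ = Σ wᵢ`, is onto `V` with the same kernel as `T`
    let Φ : (s → Z) →ₗ[F] V :=
      { toFun := fun z => T z (∑ i, w i)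
        map_add' := fun z z' => by rw [hTadd, LinearMap.add_apply]
        map_smul' := fun c z => by rw [hTsmul, LinearMap.smul_apply, RingHom.id_apply] }
    have hΦ : ∀ z, Φ z = ∑ i, z i • w i := by
      intro z
      change T z (∑ i, w i) = _
      rw [map_sum]
      exact Finset.sum_congr rfl fun i _ => hT z i (w i) (hwN i)
    have hker : LinearMap.ker Φ = LinearMap.ker Talg.toLinearMap := by
      apply le_antisymm
      · intro z hz
        rw [LinearMap.mem_ker, hΦ] at hz
        rw [LinearMap.mem_ker, AlgHom.toLinearMap_apply, hTalg]
        refine hTzero z fun i => ?_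
        -- independence of the `Nᵢ`
        have hdisj := hind' i
        rw [Submodule.disjoint_def] at hdisj
        refine hdisj _ ((N i).smul_mem _ (hwN i)) ?_
        have : z i • w i = -∑ j ∈ Finset.univ.erase i, z j • w j := by
          rw [eq_neg_iff_add_eq_zero, add_comm, Finset.sum_erase_add _ _ (Finset.mem_univ i)]
          exact hz
        rw [this]
        refine Submodule.neg_mem _ (Submodule.sum_mem _ fun j hj => ?_)
        exact Submodule.mem_iSup_of_mem j (Submodule.mem_iSup_of_mem (Finset.ne_of_mem_erase hj)
          ((N j).smul_mem _ (hwN j)))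
      · intro z hz
        rw [LinearMap.mem_ker, AlgHom.toLinearMap_apply, hTalg] at hz
        rw [LinearMap.mem_ker]
        change T z (∑ i, w i) = 0
        rw [hz, LinearMap.zero_apply]
    have hrange : LinearMap.range Φ = ⊤ := by
      rw [eq_top_iff]
      rintro v -
      refine hgen (fun v => v ∈ LinearMap.range Φ) (fun i u hu => ?_) (Submodule.zero_mem _)
        (fun u v hu hv => Submodule.add_mem _ hu hv) v
      obtain ⟨c, hc⟩ := hcyc i u hu
      refine ⟨Pi.single i c, ?_⟩
      rw [hΦ, Finset.sum_eq_single i (fun j _ hj => by rw [Pi.single_eq_of_ne hj, zero_smul])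
        (fun h => absurd (Finset.mem_univ i) h), Pi.single_eq_same, hc]
    have h1 := LinearMap.finrank_range_add_finrank_ker Φ
    have h2 := LinearMap.finrank_range_add_finrank_ker Talg.toLinearMap
    rw [hrange, finrank_top, hker] at h1
    have h4 : Subalgebra.toSubmodule Talg.range = LinearMap.range Talg.toLinearMap := by
      ext x
      simp only [Subalgebra.mem_toSubmodule, AlgHom.mem_range, LinearMap.mem_range,
        AlgHom.toLinearMap_apply]
    rw [← Subalgebra.finrank_toSubmodule, h4]
    omega

end Etale

end Commutant

end Summit.HodgeConjecture.HodgeConjecture.Ring2Transport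

end
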